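import Summits.SmoothPoincare4.SmoothPoincare4.Theses.SchoenfliesSplit
import Literature.Topology.FourManifolds.MorseReebSphereProofs

/-!
# `SchsplitCerf` — deleting all smoothness of the gluing data does not make it refutable

Crux `SchoenfliesSplit.SchsplitCerf` (item stmt-SmoothPoincare4-8758), cdisprove seat.  Consider the
WEAKENING of the crux in which the two closed 4-discs are glued by merely continuous injective maps
covering `P` and meeting exactly along an arbitrary HOMEOMORPHISM `σ` of `S³` (instead of smooth
embeddings along a diffeomorphism), the conclusion `P ≅ S⁴` (smoothly) unchanged:

* `not_smoothPoincare4_of_not_topologicalGluing` — this weakening is still a consequence of the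
  summit (a topological two-disc cover forces `P ≃ₜ S⁴`: tree `TwoDiscCover.homeomorphSphere`,
  Alexander trick), so refuting it is refuting `SmoothPoincare4`;
* `not_topologicalGluing_of_not_schsplitCerf` — and it implies the crux.

So the smoothness hypotheses on the gluing data are load-bearing for the proof METHOD only (collars,
gluing uniqueness, Cerf), never for the truth value modulo the summit: no weakening of them yields a
statement killable by a cheap witness.
-/

noncomputable section

-- the prescribed namespace `Summit.<P>.<Sub>.…` duplicates `SmoothPoincare4` (P = Sub)
set_option linter.dupNamespace false

open scoped Manifold ContDiff Topology
open Set Function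

namespace Summit.SmoothPoincare4.SmoothPoincare4.Theorems.SchsplitCerf.Negative

open Literature.Topology.FourManifolds
open Summit.SmoothPoincare4.SmoothPoincare4.Theses.SchoenfliesSplit (SchsplitCerf)

/-- **Refuting the topological-gluing weakening of the crux refutes the summit.** [cite: Milnor1963, Thm. 4.1 (proof, p. 25)] -/
theorem not_smoothPoincare4_of_not_topologicalGluing
    (h : ¬ ∀ (σ : (Metric.sphere (0 : EuclideanSpace ℝ (Fin 4)) 1) ≃ₜ
            (Metric.sphere (0 : EuclideanSpace ℝ (Fin 4)) 1))
          (P : Type) [TopologicalSpace P] [T2Space P] [SecondCountableTopology P]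
          [ChartedSpace (EuclideanSpace ℝ (Fin 4)) P] [IsManifold (𝓡 4) ∞ P],
          (∃ jA jB : (Metric.closedBall (0 : EuclideanSpace ℝ (Fin 4)) 1) → P,
            Continuous jA ∧ Continuous jB ∧ Injective jA ∧ Injective jB ∧
            range jA ∪ range jB = univ ∧
            ∀ a b, jA a = jB b ↔ ∃ z : Metric.sphere (0 : EuclideanSpace ℝ (Fin 4)) 1,
              a = Set.inclusion Metric.sphere_subset_closedBall z ∧
              b = Set.inclusion Metric.sphere_subset_closedBall (σ z)) →
          Nonempty (P ≃ₘ⟮𝓡 4, 𝓡 4⟯ (Metric.sphere (0 : EuclideanSpace ℝ (Fin 5)) 1))) :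
    ¬ _root_.SmoothPoincare4 := by
  intro hs
  refine h ?_
  intro σ P _ _ _ _ _ hP
  obtain ⟨jA, jB, hcA, hcB, hiA, hiB, hU, hR⟩ := hP
  let C : TwoDiscCover 3 P :=
    { σ := σ, jA := jA, jB := jB, continuous_jA := hcA, continuous_jB := hcB,
      injective_jA := hiA, injective_jB := hiB, range_union := hU, apply_eq_apply_iff := hR }
  haveI : CompactSpace P :=
    ⟨by rw [← hU]; exact (isCompact_range hcA).union (isCompact_range hcB)⟩
  exact hs P inferInstance inferInstance C.homeomorphSphere.toHomotopyEquiv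

/-- **The topological-gluing weakening implies the crux** (contrapositive form: a counterexample
to the crux, read through `IsTwistedSphere`, is a counterexample to the weakening). [folklore] -/
theorem not_topologicalGluing_of_not_schsplitCerf (h : ¬ SchsplitCerf) :
    ¬ ∀ (σ : (Metric.sphere (0 : EuclideanSpace ℝ (Fin 4)) 1) ≃ₜ
            (Metric.sphere (0 : EuclideanSpace ℝ (Fin 4)) 1))
          (P : Type) [TopologicalSpace P] [T2Space P] [SecondCountableTopology P]
          [ChartedSpace (EuclideanSpace ℝ (Fin 4)) P] [IsManifold (𝓡 4) ∞ P],
          (∃ jA jB : (Metric.closedBall (0 : EuclideanSpace ℝ (Fin 4)) 1) → P,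
            Continuous jA ∧ Continuous jB ∧ Injective jA ∧ Injective jB ∧
            range jA ∪ range jB = univ ∧
            ∀ a b, jA a = jB b ↔ ∃ z : Metric.sphere (0 : EuclideanSpace ℝ (Fin 4)) 1,
              a = Set.inclusion Metric.sphere_subset_closedBall z ∧
              b = Set.inclusion Metric.sphere_subset_closedBall (σ z)) →
          Nonempty (P ≃ₘ⟮𝓡 4, 𝓡 4⟯ (Metric.sphere (0 : EuclideanSpace ℝ (Fin 5)) 1)) := by
  intro hw
  refine h ?_
  intro _ φ T
  obtain ⟨jA, jB, hA, hB, hU, hR⟩ := T.isTwistedSphere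
  exact hw φ.toHomeomorph T.carrier ⟨jA, jB, hA.isEmbedding.continuous, hB.isEmbedding.continuous,
    hA.isEmbedding.injective, hB.isEmbedding.injective, hU,
    fun a b => by simpa [closedBallBoundaryData_incl] using hR a b⟩

end Summit.SmoothPoincare4.SmoothPoincare4.Theorems.SchsplitCerf.Negative

end
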